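import Literature.AnabelianGeometry.EtaleTheta.SettingModelTateMuTwo
import HarnessLib

/-!
# The STAGE-2 («Tate shear») model of [EtTh] §1–2, part F4q-C (sequel): C-LEVEL DATA for `MuTwoSetting.modelχq` and
# `ε_±`-conjugation = the stage-2 inversion

S. Mochizuki, *The étale theta function …*, Publ. RIMS **45** (2009) [EtTh], Def. 1.7 p. 27 («`X^log → C^log`»), §2 p. 36
(«`1 → Δ_C → Π_C → G_K → 1`», «`ι` … "multiplication by `−1`"») [cite: MochizukiEtTh2009, Def 1.7 p.27]; [IUTchII]
Rmk. 1.4.1 (ii) p. 28 [cite: Mochizuki2012, Rmk 1.4.1 (ii) p.28].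

Cell abc-iut, layer L2, R78 cluster STAGE 2 (row R244 «F4q-C»), seat abc-iut-w5-d249 (gen 5).  Over this seat's
`SettingModelTateMuTwo.lean` (`PiTpCq`, `invActionχq`, `MuTwoSetting.modelχq`), F4q (`augχq`), F4q-ι (`inversionχq`,
`inversionχq_inr_of_eq`) and abc-iut-L2-d3's `MuTwoSetting.CLevelData` / `CLevelData.conjX` — consumed BY NAME.

* `augCq : Π^tp_C →ₜ* G_{ℚ_p}`, `(x, z) ↦ aug x` (`SemidirectProduct.lift aug 1`, well defined because `ι` is over `G_{ℚ_p}`),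
  continuous, onto `G_{ℚ_p} = G_K`;
* **`MuTwoSetting.modelχq_cLevelData : (MuTwoSetting.modelχq p i j hj).CLevelData`** (`inl` an open embedding, `augC`);
* for EVERY C-level datum `e` of the record: **`conjX_epsPM_modelχq : e.conjX ε_± = inversionχq p i j`**, hence (R1b′)
  `conjX_epsPM_mem_deltaTemp_iff`, (R1c) `toZ_conjX_epsPM_modelχq` (degree reversal), `conjX_epsPM_modelχq_ne_refl`, and at the
  Tate instance `(1, 2)` **`conjX_epsPM_modelχq_inr_one_two`** (`ε_±` FIXES the canonical Galois section); (R1e′) «`ι̂ ≡ −1` on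
  `Δ_X^ab`» is abc-iut-L2-t10's `inversionχq_hinv` (p437157).
HONEST LABEL: semi-synthetic model — consistency evidence only; nothing of [EtTh] asserted; no side taken on [IUTchIII] Cor. 3.12;
typed ≠ proved.  Class (b) (defs: `augCq`, `epsZCq`, the C-level data record; no instances, no Prop facts).
-/

noncomputable section

namespace Literature.AnabelianGeometry.EtaleTheta.SettingModel

open Literature.AnabelianGeometry.SemiGraphs
open Function
open _root_.Topology

variable (p : ℕ) [Fact p.Prime] (i j : ℤ) (hj : Even j)

/-! ## §5. C-level data: the augmentation `Π^tp_C → G_{ℚ_p}` -/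

/-- `aug ∘ φ(z) = aug` in the form `SemidirectProduct.lift` wants (trivial second component).
[cite: Mochizuki2012, Rmk 1.4.1 (ii) p.28] -/
theorem augχq_comp_invActionχq (z : Multiplicative (ZMod 2)) :
    (augχq p i j).toMonoidHom.comp (invActionχq p i j z).toMonoidHom =
      (MulAut.conj ((1 : Multiplicative (ZMod 2) →* GQp p) z)).toMonoidHom.comp (augχq p i j).toMonoidHom := by
  refine MonoidHom.ext fun x => ?_
  simp only [MonoidHom.comp_apply, MulEquiv.coe_toMonoidHom, MonoidHom.one_apply, map_one, MulAut.one_apply]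
  exact augχq_invActionχq p i j z x

/-- **The augmentation `Π^tp_C → G_{ℚ_p}`**: `(x, z) ↦ aug x` (a homomorphism because `ι` is over `G_{ℚ_p}`), continuous.
[cite: MochizukiEtTh2009, §2 p.36] -/
def augCq : PiTpCq p i j →ₜ* GQp p where
  toMonoidHom := SemidirectProduct.lift (augχq p i j).toMonoidHom 1 (augχq_comp_invActionχq p i j)
  continuous_toFun := by
    change Continuous fun g : PiTpCq p i j =>
      SemidirectProduct.lift (augχq p i j).toMonoidHom 1 (augχq_comp_invActionχq p i j) g
    have h : (fun g : PiTpCq p i j => SemidirectProduct.lift (augχq p i j).toMonoidHom 1 (augχq_comp_invActionχq p i j) g) =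
        fun g => augχq p i j g.left := by
      funext g
      change (augχq p i j).toMonoidHom g.left * (1 : Multiplicative (ZMod 2) →* GQp p) g.right = _
      rw [MonoidHom.one_apply, mul_one]
      rfl
    rw [h]
    exact (augχq p i j).continuous.comp (Semidirect.continuous_left (isInducing_leftRightCq p i j))

/-- `augC (inl x) = aug x`. [cite: MochizukiEtTh2009, §2 p.36] -/
theorem augCq_inl (x : PiTpχq p i j) : augCq p i j (SemidirectProduct.inl x) = augχq p i j x :=
  SemidirectProduct.lift_inl (augχq p i j).toMonoidHom 1 (augχq_comp_invActionχq p i j) x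

/-- `augC (x, z) = aug x`. [cite: MochizukiEtTh2009, §2 p.36] -/
theorem augCq_apply (g : PiTpCq p i j) : augCq p i j g = augχq p i j g.left := by
  change (augχq p i j).toMonoidHom g.left * (1 : Multiplicative (ZMod 2) →* GQp p) g.right = _
  rw [MonoidHom.one_apply, mul_one]
  rfl

/-- `augC` is onto `G_{ℚ_p} = G_K`. [cite: MochizukiEtTh2009, §2 p.36] -/
theorem range_augCq : (augCq p i j).toMonoidHom.range = ⊤ :=
  MonoidHom.range_eq_top.mpr fun σ =>
    ⟨SemidirectProduct.inl (SemidirectProduct.inr σ), (augCq_inl p i j (SemidirectProduct.inr σ)).trans rfl⟩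

/-- **The stage-2 Def. 1.7 record CARRIES C-level data**: `inl` is an open embedding and `augC := lift aug 1` extends `aug`
with image `G_K = G_{ℚ_p}`. [cite: MochizukiEtTh2009, Def 1.7 p.27] -/
def _root_.Literature.AnabelianGeometry.EtaleTheta.MuTwoSetting.modelχq_cLevelData :
    (MuTwoSetting.modelχq p i j hj).CLevelData where
  isOpenEmbedding_inclX := isOpenEmbedding_inlCq p i j
  augC := augCq p i j
  augC_inclX := augCq_inl p i j
  range_augC := by
    rw [range_augCq]
    exact (IntermediateField.fixingSubgroup_bot).symm

/-- **Non-vacuity of the C-level data at stage 2.** [cite: MochizukiEtTh2009, Def 1.7 p.27] -/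
theorem _root_.Literature.AnabelianGeometry.EtaleTheta.MuTwoSetting.nonempty_cLevelData_modelχq :
    Nonempty (MuTwoSetting.modelχq p i j hj).CLevelData :=
  ⟨MuTwoSetting.modelχq_cLevelData p i j hj⟩

/-! ## §6. `e.conjX ε_±` is the stage-2 inversion, for every C-level datum -/

/-- **For every C-level datum `e` of the stage-2 record, `e.conjX ε_± = inversionχq p i j`** (conjugation by `ε_± = (1, 1̄)`
on `Π^tp_X ⊴ Π^tp_X ⋊_ι ℤ/2` is `ι`; `conjX` depends on `e` only through continuity). [cite: MochizukiEtTh2009, §2 p.36] -/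
theorem conjX_epsPM_modelχq (e : (MuTwoSetting.modelχq p i j hj).CLevelData) :
    e.conjX (MuTwoSetting.modelχq p i j hj).epsPM = inversionχq p i j := by
  refine ContinuousMulEquiv.ext fun x => (MuTwoSetting.modelχq p i j hj).injective_inclX ?_
  rw [e.inclX_conjX]
  exact MuTwoSetting.modelχq_epsPM_conj p i j hj x

/-- (R1b′) for `ι := e.conjX ε_±`: `ι` maps `Δ^tp_X` into itself (indeed onto: `ι² = 1`). [cite: Mochizuki2012, Rmk 1.4.1 (ii) p.28] -/
theorem conjX_epsPM_mem_deltaTemp_iff (e : (MuTwoSetting.modelχq p i j hj).CLevelData) (x : PiTpχq p i j) :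
    e.conjX (MuTwoSetting.modelχq p i j hj).epsPM x ∈ (curveχq p i j).DeltaTemp ↔ x ∈ (curveχq p i j).DeltaTemp := by
  rw [conjX_epsPM_modelχq]
  exact inversionχq_mem_deltaTemp_iff p i j x

/-- (R1c) for `ι := e.conjX ε_±`: the degree is REVERSED, `toZ (ι g) = (toZ g)⁻¹`. [cite: Mochizuki2012, Prop 2.2 (ii) p.66] -/
theorem toZ_conjX_epsPM_modelχq (e : (MuTwoSetting.modelχq p i j hj).CLevelData) (g : PiTpχq p i j) :
    (MuTwoSetting.modelχq p i j hj).toZ (e.conjX (MuTwoSetting.modelχq p i j hj).epsPM g) =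
      ((MuTwoSetting.modelχq p i j hj).toZ g)⁻¹ := by
  rw [conjX_epsPM_modelχq]
  exact gfpSnd_left_inversionχq p i j g

/-- `e.conjX ε_±` is NOT the identity (an outer automorphism of `Π^tp_X`). [cite: MochizukiEtTh2009, Def 1.7 p.27] -/
theorem conjX_epsPM_modelχq_ne_refl (e : (MuTwoSetting.modelχq p i j hj).CLevelData) :
    (e.conjX (MuTwoSetting.modelχq p i j hj).epsPM).toMulEquiv ≠ MulEquiv.refl _ := by
  rw [conjX_epsPM_modelχq]
  exact inversionχq_ne_refl p i j

/-- **At the Tate instance `(i, j) = (1, 2)`, `ε_±`-conjugation FIXES the canonical Galois section** (`ι (1, σ) = (1, σ)`: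
this seat's `inversionχq_inr_of_eq`). [cite: Mochizuki2012, Rmk 1.4.1 (ii) p.28] -/
theorem conjX_epsPM_modelχq_inr_one_two (e : (MuTwoSetting.modelχq p 1 2 even_two).CLevelData)
    (σ : GQp p) :
    e.conjX (MuTwoSetting.modelχq p 1 2 even_two).epsPM (SemidirectProduct.inr σ) =
      SemidirectProduct.inr σ := by
  rw [conjX_epsPM_modelχq, inversionχq_apply, tateInversion_inr, invDefect_tatePairHom]
  have h : (-1 + -1 + 2 : ℤ) = 0 := by norm_num
  rw [h, zpow_zero, map_one, map_one, one_mul]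


/-! ## §7. The remaining Def. 1.7 facets of the record: guard, `Compat`, admissible `ε_Z := a`, (R1d) -/

/-- The stage-2 Def. 1.7 record satisfies the origin guard `IsEtThOrigin` (abc-iut-L2-t5). [cite: MochizukiEtTh2009, §1 p.12] -/
theorem _root_.Literature.AnabelianGeometry.EtaleTheta.MuTwoSetting.modelχq_isEtThOrigin :
    (MuTwoSetting.modelχq p i j hj).toThetaSetting.IsEtThOrigin :=
  ThetaSetting.modelχq_isEtThOrigin p i j hj

/-- … and `Compat`. [cite: MochizukiEtTh2009, Prop 1.5 p.22] -/
theorem _root_.Literature.AnabelianGeometry.EtaleTheta.MuTwoSetting.modelχq_compat :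
    (MuTwoSetting.modelχq p i j hj).toThetaSetting.Compat :=
  (ThetaSetting.modelχq p i j hj).compat

/-- **`ε_Z := a`**, the deck generator embedded in `Π^tp_C` (a representative of `ε_Z ∈ Gal(Ẍ/X)`, p. 27).
[cite: MochizukiEtTh2009, Def 1.7 p.27] -/
def epsZCq : PiTpCq p i j := SemidirectProduct.inl (SemidirectProduct.inl (gfpOf (FreeGroup.of 0)))

/-- `a ∉ Π^tp_Ẍ` at stage 2 (parity `(1, 0)`). [cite: MochizukiEtTh2009, Def 1.7 p.27] -/
theorem inl_a_not_mem_Xddχq : (SemidirectProduct.inl (gfpOf (FreeGroup.of 0)) : PiTpχq p i j) ∉ Xddχq p i j hj := by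
  rw [mem_Xddχq_iff, SemidirectProduct.left_inl, mem_dXdd_iff, levelHom_gfpOf_a]
  rintro ⟨h, -⟩
  exact absurd (h : (1 : ZMod 2) = 0) (by decide)

/-- `a·b⁻¹ ∉ Π^tp_Ẍ` at stage 2 (parity `(1, 1)`). [cite: MochizukiEtTh2009, Def 1.7 p.27] -/
theorem inl_a_mul_inv_b_not_mem_Xddχq :
    (SemidirectProduct.inl (gfpOf (FreeGroup.of 0)) : PiTpχq p i j) * (SemidirectProduct.inl (gfpOf (FreeGroup.of 1)))⁻¹ ∉
      Xddχq p i j hj := by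
  rw [← map_inv, ← map_mul, mem_Xddχq_iff, SemidirectProduct.left_inl, mem_dXdd_iff, map_mul, map_inv,
    levelHom_gfpOf_a, levelHom_gfpOf, heisHom_of_one, Heis.map_apply, Heis.mul_x, Heis.inv_x, map_zero, neg_zero,
    add_zero]
  rintro ⟨h, -⟩
  exact absurd (h : (1 : ZMod 2) = 0) (by decide)

/-- **`ε_Z := a` is admissible** at stage 2 (`a ∈ Π^tp_X ∖ Π^tp_Ẍ`, `a·ε_μ⁻¹ = a·b⁻¹ ∉ Π^tp_Ẍ`).
[cite: MochizukiEtTh2009, Def 1.7 p.27] -/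
theorem _root_.Literature.AnabelianGeometry.EtaleTheta.MuTwoSetting.modelχq_isAdmissibleEpsZ :
    (MuTwoSetting.modelχq p i j hj).IsAdmissibleEpsZ (epsZCq p i j) := by
  refine ⟨⟨SemidirectProduct.inl (gfpOf (FreeGroup.of 0)), rfl⟩, ?_, ?_⟩
  · intro hmem
    obtain ⟨y, hy, hyy⟩ := Subgroup.mem_map.mp hmem
    have h := SemidirectProduct.inl_injective hyy
    subst h
    exact inl_a_not_mem_Xddχq p i j hj hy
  · intro hmem
    have hmem' : (SemidirectProduct.inl (SemidirectProduct.inl (gfpOf (FreeGroup.of 0)) *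
        (SemidirectProduct.inl (gfpOf (FreeGroup.of 1)))⁻¹ : PiTpχq p i j) : PiTpCq p i j) ∈
          (Xddχq p i j hj).map (SemidirectProduct.inl : PiTpχq p i j →* PiTpCq p i j) := by
      rw [map_mul, map_inv]
      exact hmem
    obtain ⟨y, hy, hyy⟩ := Subgroup.mem_map.mp hmem'
    have h := SemidirectProduct.inl_injective hyy
    subst h
    exact inl_a_mul_inv_b_not_mem_Xddχq p i j hj hy

/-- **(R1d)**: `inclX = inl` induces the topology of `Π^tp_X`. [cite: MochizukiEtTh2009, Def 1.7 p.27] -/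
theorem _root_.Literature.AnabelianGeometry.EtaleTheta.MuTwoSetting.isInducing_inclX_modelχq :
    IsInducing (MuTwoSetting.modelχq p i j hj).inclX :=
  (isOpenEmbedding_inlCq p i j).isInducing

/-- **Joint satisfiability at the Tate-shear model**: Def. 1.7's interface admits, over the stage-2 root
`ThetaSetting.modelχq p i j hj`, a record with C-level data whose `ε_±` acts on `Π^tp_X` as the cocycle-corrected inversion —
a nontrivial involution over `G_K` reversing the degree — together with the guard, `Compat` and an admissible `ε_Z`.
[cite: MochizukiEtTh2009, Def 1.7 p.27] -/
theorem _root_.Literature.AnabelianGeometry.EtaleTheta.MuTwoSetting.exists_cLevelData_conjX_epsPM_tateInversion :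
    ∃ (M : MuTwoSetting p) (e : M.CLevelData) (εZ : M.GtpC), M.toThetaSetting = ThetaSetting.modelχq p i j hj ∧
      M.toThetaSetting.IsEtThOrigin ∧ M.toThetaSetting.Compat ∧ M.IsAdmissibleEpsZ εZ ∧
      (e.conjX M.epsPM).toMulEquiv ≠ MulEquiv.refl _ ∧
      (∀ x, e.conjX M.epsPM (e.conjX M.epsPM x) = x) ∧
      (∀ x, M.aug (e.conjX M.epsPM x) = M.aug x) ∧
      ∀ x, M.toZ (e.conjX M.epsPM x) = (M.toZ x)⁻¹ :=
  ⟨MuTwoSetting.modelχq p i j hj, MuTwoSetting.modelχq_cLevelData p i j hj, epsZCq p i j, rfl,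
    MuTwoSetting.modelχq_isEtThOrigin p i j hj, MuTwoSetting.modelχq_compat p i j hj,
    MuTwoSetting.modelχq_isAdmissibleEpsZ p i j hj, conjX_epsPM_modelχq_ne_refl p i j hj _,
    fun x => by rw [conjX_epsPM_modelχq]; exact inversionχq_inversionχq p i j x,
    fun x => by rw [conjX_epsPM_modelχq]; exact augχq_inversionχq p i j x,
    toZ_conjX_epsPM_modelχq p i j hj _⟩

end Literature.AnabelianGeometry.EtaleTheta.SettingModel

end
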